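import Literature.AnabelianGeometry.SemiGraphs.TemperedVerticial
import Literature.AnabelianGeometry.SemiGraphs.MorphismsOver
import HarnessLib

/-!
# [SemiAnbd] Def. 2.3 (i)–(ii): print's approximators and the typed `Approximator` carry the same data
# on a connected semi-graph of anabelioids with a vertex (faithfulness refinement)

Mochizuki, *Semi-graphs of anabelioids*, Publ. RIMS **42** (2006), §2, Definition 2.3 (i)–(iii),
manuscript pp. 24–25 [cite: MochizukiSemiAnbd2006, Def 2.3 pp.24-25] ("(i) We shall say that `G` is of
bounded order if there exists an integer `M ≥ 1` such that all of the `π̂₁(G_v)`'s, where `v` ranges over the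
vertices of the underlying semi-graph `𝔾`, are finite groups of order dividing `M`. (ii) We shall refer to a
morphism of semi-graphs of anabelioids `G → G′` which induces an isomorphism on underlying semi-graphs …
and for which `G′` is a semi-graph of anabelioids of bounded order as an approximator for `G`"), Definition
2.4 (i) p. 25, and §2 p. 23 l. 1–3 ("If `G` has no vertices — and hence precisely one edge `e`, which is
necessarily isolated — …").

PROOF-ONLY companion (abc-iut cell, layer L3, seat abc-iut-L3-t2 gen 5, row «APPROX-COARSENING» of
abc-iut-L3-lead α111; label [faithfulness refinement; not a cone member]) of `TemperedVerticial.lean`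
(referee lane E14 b1 freeze, untouched).  That file's `ProfiniteSemiGraph.Approximator` DISCLOSES a
coarsening: it asks the EDGE groups `F_e = π̂₁(G′_e)` to be finite, whereas print's "of bounded order"
bounds only the VERTEX groups.  Here the print form is spelled out literally — `G′` of injective type on the
same semi-graph with profinite vertex and edge groups (the tree's convention for `π̂₁` of a connected
anabelioid, as in `ProfiniteSemiGraph`: compact totally disconnected topological groups) and continuous
injective branch maps, VERTEX groups finite of order dividing `M`, EDGE groups arbitrary, together with
continuous `Π_v → F_v`, `Π_e → F_e` compatible with the `b_*` up to conjugation (Rmk. 2.4.2) — with its data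
UNBUNDLED as binders (no structure is declared), and it is PROVED that on a connected semi-graph of
anabelioids with at least one vertex (two of the standing hypotheses of Prop. 3.6 / Thm. 3.7, fields
`isConnected`, `hasVertex` of `Prop36Hypotheses`) the two notions carry the same data:
* `finite_edgeGroup_of_printApproximator`, `card_edgeGroup_dvd_of_printApproximator` — every edge has a
  branch abutting to a vertex (no isolated edge, p. 23; the tree's `SemiGraph.exists_abuts_of_isConnected`),
  hence in a print-form approximator every edge group embeds in a vertex group: it is finite, of order
  dividing `M`;
* (private helpers) for a finite T₁ (= discrete) target, continuity of `Π_c → F_c` is openness of the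
  kernel (the typed field); a totally disconnected space is T₁;
* `exists_approximator_of_printForm` — so print-form data IS a typed `Approximator` (same `F_v`, `F_e`,
  `Π_v → F_v`, `Π_e → F_e`, branch maps), and conversely (`Approximator.printForm`) every typed approximator
  is print-form data for the discrete topologies;
* `isQuasiCoherent_iff_printForm`, `isElevatedVertex_iff_printForm` — Def. 2.3 (iii) and Def. 2.4 (i) read
  with print-form approximators are EQUIVALENT to the typed `IsQuasiCoherent`, `IsElevatedVertex`;
  corollaries `Prop36Hypotheses.isQuasiCoherent_printForm` / `….isElevatedVertex_printForm`.
(Print itself presupposes the edge groups of `G′` finite: Def. 2.3 (iii) speaks of "the finite étale covering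
determined by the trivial subgroup of `π̂₁(G′_c)`" for every component `c`, edges included.)
So the disclosed coarsening is immaterial to `Prop36Hypotheses` / `Thm37Hypotheses` and to every typed
statement over them (in particular to the kernel events on the typed forms of Thm. 3.7 (iii)/(iv)).  The
only separating example lives outside these hypotheses: the vertex-free semi-graph with one isolated edge
`e` (where print sets `B(G) := G_e`, p. 23) admits print-form approximators with `F_e` infinite.
No definition, no instance, no new named fact; nothing here bears on [IUTchIII] Cor. 3.12.
-/

open Topology

namespace Literature.AnabelianGeometry.SemiGraphs

universe u

/-! ### Continuity versus open kernel for finite discrete targets -/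

section Kernel

variable {P F : Type*} [Group P] [TopologicalSpace P] [Group F] [TopologicalSpace F]

/-- A continuous homomorphism to a finite T₁ (hence discrete) group has open kernel — the typed fields
`isOpen_ker_πV` / `isOpen_ker_πE` of `Approximator` from print's continuity. [folklore] -/
private theorem isOpen_ker_of_continuous_of_finite [T1Space F] [Finite F] (π : P →* F) (hπ : Continuous π) :
    IsOpen (π.ker : Set P) := by
  have h : (π.ker : Set P) = π ⁻¹' {1} := by
    ext x
    simp [MonoidHom.mem_ker]
  rw [h]
  exact (isOpen_discrete _).preimage hπ

/-- Conversely, a homomorphism of a topological group to a discrete group with open kernel is continuous.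
[folklore] -/
private theorem continuous_of_isOpen_ker [IsTopologicalGroup P] [DiscreteTopology F] (π : P →* F)
    (hπ : IsOpen (π.ker : Set P)) : Continuous π := by
  refine continuous_discrete_rng.mpr fun b => ?_
  rw [isOpen_iff_mem_nhds]
  intro g hg
  have hsub : (fun k => g * k) '' (π.ker : Set P) ⊆ π ⁻¹' {b} := by
    rintro _ ⟨k, hk, rfl⟩
    have hk' : π k = 1 := (MonoidHom.mem_ker).mp hk
    have hg' : π g = b := hg
    show π (g * k) ∈ ({b} : Set F)
    rw [map_mul, hk', mul_one, hg']
    exact Set.mem_singleton b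
  refine Filter.mem_of_superset ?_ hsub
  exact ((Homeomorph.mulLeft g).isOpenMap _ hπ).mem_nhds ⟨1, π.ker.one_mem, mul_one g⟩

/-- A totally disconnected space is T₁ (its points are its connected components, which are closed).
[folklore] -/
private theorem t1Space_of_totallyDisconnectedSpace (X : Type*) [TopologicalSpace X] [TotallyDisconnectedSpace X] :
    T1Space X :=
  ⟨fun x => by rw [← connectedComponent_eq_singleton x]; exact isClosed_connectedComponent⟩

end Kernel

namespace ProfiniteSemiGraph

variable {𝒢 : ProfiniteSemiGraph.{u}}

/-! ### Print-form approximators have finite edge groups -/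

section PrintForm

variable {FV : 𝒢.graph.Vertex → Type u} {FE : 𝒢.graph.Edge → Type u}
  [∀ v, Group (FV v)] [∀ v, TopologicalSpace (FV v)] [∀ e, Group (FE e)] [∀ e, TopologicalSpace (FE e)]

/-- **In a print-form approximator of a connected semi-graph of anabelioids with a vertex, every edge group
is finite**: the edge abuts to some vertex `v` through a branch `b` (p. 23) and `b_* : F_e ↪ F_v` is
injective (`G′` of injective type) with `F_v` finite (bounded order, Def. 2.3 (i)).
[cite: MochizukiSemiAnbd2006, Def 2.3 pp.24-25] -/
theorem finite_edgeGroup_of_printApproximator [∀ v, Finite (FV v)]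
    (brF : ∀ (b : 𝒢.graph.Branch) (v : 𝒢.graph.Vertex), 𝒢.graph.abuts b = some v →
      (FE (𝒢.graph.edgeOf b) →ₜ* FV v))
    (hinj : ∀ b v h, Function.Injective (brF b v h)) (hconn : 𝒢.IsConnected)
    (hV : 𝒢.HasVertex) (e : 𝒢.graph.Edge) : Finite (FE e) := by
  obtain ⟨v₀⟩ := hV
  obtain ⟨b, hbe, hb⟩ := SemiGraph.exists_abuts_of_isConnected hconn v₀ e
  obtain ⟨v, hbv⟩ := Option.isSome_iff_exists.mp hb
  subst hbe
  exact Finite.of_injective _ (hinj b v hbv)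

/-- Moreover the edge groups are of order dividing the bound `M` of Def. 2.3 (i): `|F_e| ∣ |F_v| ∣ M`.
[cite: MochizukiSemiAnbd2006, Def 2.3 pp.24-25] -/
theorem card_edgeGroup_dvd_of_printApproximator [∀ v, Finite (FV v)]
    (brF : ∀ (b : 𝒢.graph.Branch) (v : 𝒢.graph.Vertex), 𝒢.graph.abuts b = some v →
      (FE (𝒢.graph.edgeOf b) →ₜ* FV v))
    (hinj : ∀ b v h, Function.Injective (brF b v h)) (hconn : 𝒢.IsConnected)
    (hV : 𝒢.HasVertex) {M : ℕ} (hM : ∀ v, Nat.card (FV v) ∣ M) (e : 𝒢.graph.Edge) :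
    Nat.card (FE e) ∣ M := by
  obtain ⟨v₀⟩ := hV
  obtain ⟨b, hbe, hb⟩ := SemiGraph.exists_abuts_of_isConnected hconn v₀ e
  obtain ⟨v, hbv⟩ := Option.isSome_iff_exists.mp hb
  subst hbe
  exact (Subgroup.card_dvd_of_injective (brF b v hbv).toMonoidHom (hinj b v hbv)).trans (hM v)

/-- **Print-form approximator data IS a typed `Approximator`** on a connected semi-graph of anabelioids with a
vertex: the same vertex and edge groups (with their group structures), the same `Π_v → F_v`, `Π_e → F_e` and
branch maps (the edge groups being finite by `finite_edgeGroup_of_printApproximator`, the kernels open by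
continuity into finite T₁ groups). [cite: MochizukiSemiAnbd2006, Def 2.3 pp.24-25] -/
theorem exists_approximator_of_printForm [∀ v, TotallyDisconnectedSpace (FV v)] [∀ v, Finite (FV v)]
    [∀ e, TotallyDisconnectedSpace (FE e)] (hconn : 𝒢.IsConnected) (hV : 𝒢.HasVertex)
    (πV : ∀ v, 𝒢.Gv v →ₜ* FV v) (πE : ∀ e, 𝒢.Ge e →ₜ* FE e)
    (brF : ∀ (b : 𝒢.graph.Branch) (v : 𝒢.graph.Vertex), 𝒢.graph.abuts b = some v →
      (FE (𝒢.graph.edgeOf b) →ₜ* FV v))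
    (hinj : ∀ b v h, Function.Injective (brF b v h))
    (comm : ∀ (b : 𝒢.graph.Branch) (v : 𝒢.graph.Vertex) (h : 𝒢.graph.abuts b = some v), ∃ g : FV v,
      ∀ x : 𝒢.Ge (𝒢.graph.edgeOf b), brF b v h (πE _ x) = g * πV v (𝒢.brHom b v h x) * g⁻¹)
    (bounded : ∃ M : ℕ, 0 < M ∧ ∀ v, Nat.card (FV v) ∣ M) :
    ∃ A : 𝒢.Approximator, A.FV = FV ∧ A.FE = FE ∧
      HEq A.groupFV ‹∀ v, Group (FV v)› ∧ HEq A.groupFE ‹∀ e, Group (FE e)› ∧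
      (HEq A.πV fun v => (πV v).toMonoidHom) ∧ (HEq A.πE fun e => (πE e).toMonoidHom) ∧
      HEq A.brF fun b v h => (brF b v h).toMonoidHom := by
  haveI : ∀ e, Finite (FE e) := fun e => finite_edgeGroup_of_printApproximator brF hinj hconn hV e
  haveI : ∀ v, T1Space (FV v) := fun v => t1Space_of_totallyDisconnectedSpace (FV v)
  haveI : ∀ e, T1Space (FE e) := fun e => t1Space_of_totallyDisconnectedSpace (FE e)
  exact ⟨{ FV := FV
           FE := FE
           πV := fun v => (πV v).toMonoidHom
           πE := fun e => (πE e).toMonoidHom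
           isOpen_ker_πV := fun v =>
             isOpen_ker_of_continuous_of_finite (πV v).toMonoidHom (πV v).continuous
           isOpen_ker_πE := fun e =>
             isOpen_ker_of_continuous_of_finite (πE e).toMonoidHom (πE e).continuous
           brF := fun b v h => (brF b v h).toMonoidHom
           brF_injective := hinj
           comm := comm
           bounded := bounded }, rfl, rfl, HEq.rfl, HEq.rfl, HEq.rfl, HEq.rfl, HEq.rfl⟩

end PrintForm

/-- **Conversely, every typed approximator is print-form data** for the discrete topologies on its (finite)
vertex and edge groups — profinite (finite discrete) topological groups for which `Π_v → F_v`,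
`Π_e → F_e` (and, trivially, the branch maps) are continuous. [cite: MochizukiSemiAnbd2006, Def 2.3 pp.24-25] -/
theorem Approximator.printForm (A : 𝒢.Approximator) :
    (∀ v, @Continuous _ _ _ (⊥ : TopologicalSpace (A.FV v)) (A.πV v)) ∧
      ∀ e, @Continuous _ _ _ (⊥ : TopologicalSpace (A.FE e)) (A.πE e) := by
  refine ⟨fun v => ?_, fun e => ?_⟩
  · letI : TopologicalSpace (A.FV v) := ⊥
    haveI : DiscreteTopology (A.FV v) := discreteTopology_bot _
    exact continuous_of_isOpen_ker (A.πV v) (A.isOpen_ker_πV v)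
  · letI : TopologicalSpace (A.FE e) := ⊥
    haveI : DiscreteTopology (A.FE e) := discreteTopology_bot _
    exact continuous_of_isOpen_ker (A.πE e) (A.isOpen_ker_πE e)

/-! ### Def. 2.3 (iii) and Def. 2.4 (i) with print-form approximators -/

/-- **Quasi-coherence (Def. 2.3 (iii) p. 25) read with PRINT-FORM approximators is the typed
`IsQuasiCoherent`**, for `G` connected with a vertex: "for every integer `M ≥ 1`, and every collection of
finite étale coverings `H_c → G_c` of degree `≤ M` … there exists an approximator `G → G′` such that … the
pull-back to `G_c` of the 'universal covering' `H′_c → G′_c` … splits `H_c → G_c`" — the approximator now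
being a morphism to a semi-graph of anabelioids `G′` of injective type on the same semi-graph (profinite vertex
and edge groups, continuous injective branch maps) whose VERTEX groups are finite of order dividing some `M′`
— the literal Def. 2.3 (i)–(ii), edge groups unconstrained. [cite: MochizukiSemiAnbd2006, Def 2.3(iii) p.25] -/
theorem isQuasiCoherent_iff_printForm (hconn : 𝒢.IsConnected) (hV : 𝒢.HasVertex) :
    𝒢.IsQuasiCoherent ↔
      ∀ (M : ℕ) (HV : ∀ v : 𝒢.graph.Vertex, BTemp (𝒢.Gv v)) (HE : ∀ e : 𝒢.graph.Edge, BTemp (𝒢.Ge e)),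
        (∀ v, Nat.card (HV v).obj.V ≤ M ∧ Finite (HV v).obj.V) →
        (∀ e, Nat.card (HE e).obj.V ≤ M ∧ Finite (HE e).obj.V) →
        ∃ (FV : 𝒢.graph.Vertex → Type u) (FE : 𝒢.graph.Edge → Type u)
          (_ : ∀ v, Group (FV v)) (_ : ∀ v, TopologicalSpace (FV v)) (_ : ∀ v, IsTopologicalGroup (FV v))
          (_ : ∀ v, CompactSpace (FV v)) (_ : ∀ v, TotallyDisconnectedSpace (FV v)) (_ : ∀ v, Finite (FV v))
          (_ : ∀ e, Group (FE e)) (_ : ∀ e, TopologicalSpace (FE e)) (_ : ∀ e, IsTopologicalGroup (FE e))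
          (_ : ∀ e, CompactSpace (FE e)) (_ : ∀ e, TotallyDisconnectedSpace (FE e))
          (πV : ∀ v, 𝒢.Gv v →ₜ* FV v) (πE : ∀ e, 𝒢.Ge e →ₜ* FE e)
          (brF : ∀ (b : 𝒢.graph.Branch) (v : 𝒢.graph.Vertex), 𝒢.graph.abuts b = some v →
            (FE (𝒢.graph.edgeOf b) →ₜ* FV v)),
          (∀ b v h, Function.Injective (brF b v h)) ∧
          (∀ (b : 𝒢.graph.Branch) (v : 𝒢.graph.Vertex) (h : 𝒢.graph.abuts b = some v), ∃ g : FV v,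
            ∀ x : 𝒢.Ge (𝒢.graph.edgeOf b), brF b v h (πE _ x) = g * πV v (𝒢.brHom b v h x) * g⁻¹) ∧
          (∃ M' : ℕ, 0 < M' ∧ ∀ v, Nat.card (FV v) ∣ M') ∧
          (∀ v (g : 𝒢.Gv v), πV v g = 1 → ∀ x : (HV v).obj.V, (HV v).obj.ρ g x = x) ∧
          ∀ e (g : 𝒢.Ge e), πE e g = 1 → ∀ x : (HE e).obj.V, (HE e).obj.ρ g x = x := by
  constructor
  · intro hqc M HV HE hHV hHE
    obtain ⟨A, hAV, hAE⟩ := hqc M HV HE hHV hHE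
    obtain ⟨hcV, hcE⟩ := A.printForm
    letI : ∀ v, TopologicalSpace (A.FV v) := fun _ => ⊥
    letI : ∀ e, TopologicalSpace (A.FE e) := fun _ => ⊥
    haveI : ∀ v, DiscreteTopology (A.FV v) := fun _ => discreteTopology_bot _
    haveI : ∀ e, DiscreteTopology (A.FE e) := fun _ => discreteTopology_bot _
    exact ⟨A.FV, A.FE, inferInstance, inferInstance, inferInstance, inferInstance, inferInstance,
      inferInstance, inferInstance, inferInstance, inferInstance, inferInstance, inferInstance,
      fun v => ⟨A.πV v, hcV v⟩, fun e => ⟨A.πE e, hcE e⟩,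
      fun b v h => ⟨A.brF b v h, continuous_of_discreteTopology⟩,
      A.brF_injective, A.comm, A.bounded, hAV, hAE⟩
  · intro h M HV HE hHV hHE
    obtain ⟨FV, FE, _, _, _, _, _, _, _, _, _, _, _, πV, πE, brF, hinj, comm, bounded, hsV, hsE⟩ :=
      h M HV HE hHV hHE
    haveI : ∀ e, Finite (FE e) := fun e => finite_edgeGroup_of_printApproximator brF hinj hconn hV e
    haveI : ∀ v, T1Space (FV v) := fun v => t1Space_of_totallyDisconnectedSpace (FV v)
    haveI : ∀ e, T1Space (FE e) := fun e => t1Space_of_totallyDisconnectedSpace (FE e)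
    exact ⟨{ FV := FV
             FE := FE
             πV := fun v => (πV v).toMonoidHom
             πE := fun e => (πE e).toMonoidHom
             isOpen_ker_πV := fun v =>
               isOpen_ker_of_continuous_of_finite (πV v).toMonoidHom (πV v).continuous
             isOpen_ker_πE := fun e =>
               isOpen_ker_of_continuous_of_finite (πE e).toMonoidHom (πE e).continuous
             brF := fun b v h => (brF b v h).toMonoidHom
             brF_injective := hinj
             comm := comm
             bounded := bounded }, hsV, hsE⟩

/-- **Elevatedness (Def. 2.4 (i) p. 25) read with PRINT-FORM approximators is the typed
`IsElevatedVertex`**, for `G` connected with a vertex: "for every integer `M ≥ 1`, there exists a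
`π₁`-epimorphic approximator `G → G′` for `G` such that there exists a subgroup `N_M ⊆ π̂₁(G′_v)` of order
`≥ M` which has trivial intersection with all of the conjugates, in `π̂₁(G′_v)`, of all of the `π̂₁(G′_e)`
[where `e` ranges over the edges abutting to `v`]" — with a print-form (literal Def. 2.3 (i)–(ii))
approximator, `π₁`-epimorphic meaning all `Π_v → F_v`, `Π_e → F_e` surjective.
[cite: MochizukiSemiAnbd2006, Def 2.4(i) p.25] -/
theorem isElevatedVertex_iff_printForm (hconn : 𝒢.IsConnected) (hV : 𝒢.HasVertex)
    (v₀ : 𝒢.graph.Vertex) :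
    𝒢.IsElevatedVertex v₀ ↔
      ∀ M : ℕ, ∃ (FV : 𝒢.graph.Vertex → Type u) (FE : 𝒢.graph.Edge → Type u)
          (_ : ∀ v, Group (FV v)) (_ : ∀ v, TopologicalSpace (FV v)) (_ : ∀ v, IsTopologicalGroup (FV v))
          (_ : ∀ v, CompactSpace (FV v)) (_ : ∀ v, TotallyDisconnectedSpace (FV v)) (_ : ∀ v, Finite (FV v))
          (_ : ∀ e, Group (FE e)) (_ : ∀ e, TopologicalSpace (FE e)) (_ : ∀ e, IsTopologicalGroup (FE e))
          (_ : ∀ e, CompactSpace (FE e)) (_ : ∀ e, TotallyDisconnectedSpace (FE e))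
          (πV : ∀ v, 𝒢.Gv v →ₜ* FV v) (πE : ∀ e, 𝒢.Ge e →ₜ* FE e)
          (brF : ∀ (b : 𝒢.graph.Branch) (v : 𝒢.graph.Vertex), 𝒢.graph.abuts b = some v →
            (FE (𝒢.graph.edgeOf b) →ₜ* FV v)),
          (∀ b v h, Function.Injective (brF b v h)) ∧
          (∀ (b : 𝒢.graph.Branch) (v : 𝒢.graph.Vertex) (h : 𝒢.graph.abuts b = some v), ∃ g : FV v,
            ∀ x : 𝒢.Ge (𝒢.graph.edgeOf b), brF b v h (πE _ x) = g * πV v (𝒢.brHom b v h x) * g⁻¹) ∧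
          (∃ M' : ℕ, 0 < M' ∧ ∀ v, Nat.card (FV v) ∣ M') ∧
          ((∀ v, Function.Surjective (πV v)) ∧ ∀ e, Function.Surjective (πE e)) ∧
          ∃ N : Subgroup (FV v₀), M ≤ Nat.card N ∧
            ∀ (b : 𝒢.graph.Branch) (h : 𝒢.graph.abuts b = some v₀) (g : FV v₀),
              N ⊓ ((brF b v₀ h).range.map (MulAut.conj g).toMonoidHom) = ⊥ := by
  constructor
  · intro hel M
    obtain ⟨A, hepi, N, hN, hNint⟩ := hel M
    obtain ⟨hcV, hcE⟩ := A.printForm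
    letI : ∀ v, TopologicalSpace (A.FV v) := fun _ => ⊥
    letI : ∀ e, TopologicalSpace (A.FE e) := fun _ => ⊥
    haveI : ∀ v, DiscreteTopology (A.FV v) := fun _ => discreteTopology_bot _
    haveI : ∀ e, DiscreteTopology (A.FE e) := fun _ => discreteTopology_bot _
    exact ⟨A.FV, A.FE, inferInstance, inferInstance, inferInstance, inferInstance, inferInstance,
      inferInstance, inferInstance, inferInstance, inferInstance, inferInstance, inferInstance,
      fun v => ⟨A.πV v, hcV v⟩, fun e => ⟨A.πE e, hcE e⟩,
      fun b v h => ⟨A.brF b v h, continuous_of_discreteTopology⟩,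
      A.brF_injective, A.comm, A.bounded, hepi, N, hN, hNint⟩
  · intro h M
    obtain ⟨FV, FE, _, _, _, _, _, _, _, _, _, _, _, πV, πE, brF, hinj, comm, bounded, hepi, N, hN,
      hNint⟩ := h M
    haveI : ∀ e, Finite (FE e) := fun e => finite_edgeGroup_of_printApproximator brF hinj hconn hV e
    haveI : ∀ v, T1Space (FV v) := fun v => t1Space_of_totallyDisconnectedSpace (FV v)
    haveI : ∀ e, T1Space (FE e) := fun e => t1Space_of_totallyDisconnectedSpace (FE e)
    exact ⟨{ FV := FV
             FE := FE
             πV := fun v => (πV v).toMonoidHom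
             πE := fun e => (πE e).toMonoidHom
             isOpen_ker_πV := fun v =>
               isOpen_ker_of_continuous_of_finite (πV v).toMonoidHom (πV v).continuous
             isOpen_ker_πE := fun e =>
               isOpen_ker_of_continuous_of_finite (πE e).toMonoidHom (πE e).continuous
             brF := fun b v h => (brF b v h).toMonoidHom
             brF_injective := hinj
             comm := comm
             bounded := bounded }, hepi, N, hN, hNint⟩

/-! ### At the standing hypotheses of Prop. 3.6 / Thm. 3.7 -/

/-- Under `Prop36Hypotheses` (which contain "connected" and "has at least one vertex") quasi-coherence is
insensitive to the disclosed coarsening: the typed field `isQuasiCoherent` is Def. 2.3 (iii) with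
print-form approximators. [cite: MochizukiSemiAnbd2006, Prop 3.6 p.38] -/
theorem Prop36Hypotheses.isQuasiCoherent_printForm (h36 : 𝒢.Prop36Hypotheses) :
    ∀ (M : ℕ) (HV : ∀ v : 𝒢.graph.Vertex, BTemp (𝒢.Gv v)) (HE : ∀ e : 𝒢.graph.Edge, BTemp (𝒢.Ge e)),
        (∀ v, Nat.card (HV v).obj.V ≤ M ∧ Finite (HV v).obj.V) →
        (∀ e, Nat.card (HE e).obj.V ≤ M ∧ Finite (HE e).obj.V) →
        ∃ (FV : 𝒢.graph.Vertex → Type u) (FE : 𝒢.graph.Edge → Type u)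
          (_ : ∀ v, Group (FV v)) (_ : ∀ v, TopologicalSpace (FV v)) (_ : ∀ v, IsTopologicalGroup (FV v))
          (_ : ∀ v, CompactSpace (FV v)) (_ : ∀ v, TotallyDisconnectedSpace (FV v)) (_ : ∀ v, Finite (FV v))
          (_ : ∀ e, Group (FE e)) (_ : ∀ e, TopologicalSpace (FE e)) (_ : ∀ e, IsTopologicalGroup (FE e))
          (_ : ∀ e, CompactSpace (FE e)) (_ : ∀ e, TotallyDisconnectedSpace (FE e))
          (πV : ∀ v, 𝒢.Gv v →ₜ* FV v) (πE : ∀ e, 𝒢.Ge e →ₜ* FE e)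
          (brF : ∀ (b : 𝒢.graph.Branch) (v : 𝒢.graph.Vertex), 𝒢.graph.abuts b = some v →
            (FE (𝒢.graph.edgeOf b) →ₜ* FV v)),
          (∀ b v h, Function.Injective (brF b v h)) ∧
          (∀ (b : 𝒢.graph.Branch) (v : 𝒢.graph.Vertex) (h : 𝒢.graph.abuts b = some v), ∃ g : FV v,
            ∀ x : 𝒢.Ge (𝒢.graph.edgeOf b), brF b v h (πE _ x) = g * πV v (𝒢.brHom b v h x) * g⁻¹) ∧
          (∃ M' : ℕ, 0 < M' ∧ ∀ v, Nat.card (FV v) ∣ M') ∧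
          (∀ v (g : 𝒢.Gv v), πV v g = 1 → ∀ x : (HV v).obj.V, (HV v).obj.ρ g x = x) ∧
          ∀ e (g : 𝒢.Ge e), πE e g = 1 → ∀ x : (HE e).obj.V, (HE e).obj.ρ g x = x :=
  (isQuasiCoherent_iff_printForm h36.isConnected h36.hasVertex).mp h36.isQuasiCoherent

/-- Under `Prop36Hypotheses` every vertex is elevated in the PRINT-FORM sense of Def. 2.4 (i) (print-form
`π₁`-epimorphic approximators): the typed field `isTotallyElevated` is insensitive to the disclosed
coarsening. [cite: MochizukiSemiAnbd2006, Prop 3.6 p.38] -/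
theorem Prop36Hypotheses.isElevatedVertex_printForm (h36 : 𝒢.Prop36Hypotheses) (v₀ : 𝒢.graph.Vertex) :
    ∀ M : ℕ, ∃ (FV : 𝒢.graph.Vertex → Type u) (FE : 𝒢.graph.Edge → Type u)
          (_ : ∀ v, Group (FV v)) (_ : ∀ v, TopologicalSpace (FV v)) (_ : ∀ v, IsTopologicalGroup (FV v))
          (_ : ∀ v, CompactSpace (FV v)) (_ : ∀ v, TotallyDisconnectedSpace (FV v)) (_ : ∀ v, Finite (FV v))
          (_ : ∀ e, Group (FE e)) (_ : ∀ e, TopologicalSpace (FE e)) (_ : ∀ e, IsTopologicalGroup (FE e))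
          (_ : ∀ e, CompactSpace (FE e)) (_ : ∀ e, TotallyDisconnectedSpace (FE e))
          (πV : ∀ v, 𝒢.Gv v →ₜ* FV v) (πE : ∀ e, 𝒢.Ge e →ₜ* FE e)
          (brF : ∀ (b : 𝒢.graph.Branch) (v : 𝒢.graph.Vertex), 𝒢.graph.abuts b = some v →
            (FE (𝒢.graph.edgeOf b) →ₜ* FV v)),
          (∀ b v h, Function.Injective (brF b v h)) ∧
          (∀ (b : 𝒢.graph.Branch) (v : 𝒢.graph.Vertex) (h : 𝒢.graph.abuts b = some v), ∃ g : FV v,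
            ∀ x : 𝒢.Ge (𝒢.graph.edgeOf b), brF b v h (πE _ x) = g * πV v (𝒢.brHom b v h x) * g⁻¹) ∧
          (∃ M' : ℕ, 0 < M' ∧ ∀ v, Nat.card (FV v) ∣ M') ∧
          ((∀ v, Function.Surjective (πV v)) ∧ ∀ e, Function.Surjective (πE e)) ∧
          ∃ N : Subgroup (FV v₀), M ≤ Nat.card N ∧
            ∀ (b : 𝒢.graph.Branch) (h : 𝒢.graph.abuts b = some v₀) (g : FV v₀),
              N ⊓ ((brF b v₀ h).range.map (MulAut.conj g).toMonoidHom) = ⊥ :=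
  (isElevatedVertex_iff_printForm h36.isConnected h36.hasVertex v₀).mp (h36.isTotallyElevated v₀)

end ProfiniteSemiGraph

end Literature.AnabelianGeometry.SemiGraphs
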